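import Summits.AnomalousDissipation.AnomalousDissipation.Theorems.TwoAndHalfDTwohalfdThesisSobolevCondensate

/-!
# Sobolev-condensate no-go for `TwoAndHalfD.TwohalfdThesis` (stmt-AnomalousDissipation-0206), stub SC-FAR:
# an X-witness is EVENTUALLY `L²`-far from every Sobolev comparison family

Crux `TwohalfdThesis` (= X), line `Sketch`, lead c7, section N of the skeleton (Sobolev condensates).  The
assembly `Theorems/TwoAndHalfDTwohalfdThesisSobolevCondensate.lean` proves the X-language no-go
`twohalfdThesis_witness_not_sobolevCondensing`: if `(f, ν, u₀, u)` carries the crux — an `x₃`-invariant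
admissible steady force, `ν_j → 0`, `x₃`-invariant global Leray–Hopf solutions with bounded `limsup`-mean
energy and a `j`-uniform dissipation floor `ε > 0` — then for every family of continuous, bounded, weakly
divergence-free comparison flows `W_j` with uniformly bounded enstrophy and `L²`-speed the `limsup`-mean
fluctuation `F_j := ⟨∫_{T³} ‖π_E u_j − W_j(t) ∘ π‖²⟩` does NOT tend to `0`.  This file is the quantitative
upgrade: `F_j` is bounded BELOW by some `δ > 0` for all large `j`.

Proof.  `F_j ≥ 0` (`Literature.Analysis.FluidPDE.longTimeAvgSup_nonneg`, an integral of squares).  If no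
`δ > 0` is an eventual lower bound, then for every `n` frequently `F_j < 1/(n+1)`, and
`Filter.extraction_forall_of_frequently` gives a strictly increasing `φ` with `F_{φ n} < 1/(n+1)`, so
`F ∘ φ → 0` by squeezing.  But every hypothesis of the no-go is pointwise in `j` (or a `j`-uniform bound),
hence passes to the subsequence data `(W ∘ φ, ν ∘ φ, u₀ ∘ φ, u ∘ φ)` — a subsequence of an X-witness is an
X-witness — and `twohalfdThesis_witness_not_sobolevCondensing` forbids `F ∘ φ → 0`.

* `exists_strictMono_tendsto_zero_of_not_eventually_le` — the real-sequence extraction (nonnegative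
  sequence without eventual positive lower bound ⇒ a subsequence tends to `0`);
* `stub_scWitnessFar` — the registered stub (last declaration).  Supports stmt-AnomalousDissipation-0206.

## Mathlib / Literature search

`lean search 'extraction_forall_of_frequently'` (Mathlib `Filter.extraction_forall_of_frequently`, used the
same way in `Literature/Analysis/FluidPDE/NSLerayRegularisedLimitHolds.lean`), `'longTimeAvgSup_nonneg'`
(`Literature/Analysis/FluidPDE/LongTimeAverageNonneg.lean`), `'tendsto_one_div_add_atTop_nhds_zero_nat'`,
`'exists_strictMono_tendsto_zero'` / `'tendsto_zero_of_not_eventually'` (no existing extraction lemma of this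
shape in Mathlib + project); `lean find` (prior stockroom): no matches.
-/

noncomputable section

namespace Summit.AnomalousDissipation.AnomalousDissipation.Theorems.TwohalfdThesis.SobolevCondensate

open MeasureTheory Filter Topology Set Function
open scoped ENNReal NNReal InnerProductSpace
open Literature.Analysis.FunctionSpaces Literature.Analysis.FluidPDE

set_option linter.dupNamespace false -- the registry path `AnomalousDissipation.AnomalousDissipation`

/-! ### A real-sequence extraction -/

/-- A pointwise nonnegative real sequence `F` with no eventual positive lower bound (`¬ ∃ δ > 0, ∀ᶠ j,
δ ≤ F j`) has a subsequence tending to `0`: for every `n` frequently `F j < 1/(n+1)`, extract a strictly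
increasing `φ` with `F (φ n) < 1/(n+1)` (`Filter.extraction_forall_of_frequently`) and squeeze. [folklore] -/
theorem exists_strictMono_tendsto_zero_of_not_eventually_le {F : ℕ → ℝ} (hF0 : ∀ j, 0 ≤ F j)
    (h : ¬ ∃ δ : ℝ, 0 < δ ∧ ∀ᶠ j in atTop, δ ≤ F j) :
    ∃ φ : ℕ → ℕ, StrictMono φ ∧ Tendsto (fun n => F (φ n)) atTop (𝓝 0) := by
  have hfreq : ∀ n : ℕ, ∃ᶠ j in atTop, F j < 1 / ((n : ℝ) + 1) := by
    intro n
    have h' : ¬ ∀ᶠ j in atTop, 1 / ((n : ℝ) + 1) ≤ F j := fun hev => h ⟨_, by positivity, hev⟩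
    exact (not_eventually.1 h').mono fun j hj => not_le.1 hj
  obtain ⟨φ, hφ, hφF⟩ := extraction_forall_of_frequently hfreq
  exact ⟨φ, hφ, squeeze_zero (fun n => hF0 _) (fun n => (hφF n).le)
    tendsto_one_div_add_atTop_nhds_zero_nat⟩

/-! ### The registered stub -/

/-- **SC-FAR `stub_scWitnessFar` — an X-witness is EVENTUALLY `L²`-far from every Sobolev comparison
family (quantitative form of `twohalfdThesis_witness_not_sobolevCondensing`).**  Under the hypotheses of
the X-language no-go — `x₃`-invariant admissible steady force `f`; comparison flows `W_j` continuous,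
bounded by `B`, weakly divergence free, enstrophy `≤ G`, `L²`-speed `≤ B`; `ν_j > 0`, `ν_j → 0`;
`x₃`-invariant global Leray–Hopf solutions `u_j` with bounded `limsup`-mean energy and a `j`-uniform
dissipation floor — the `limsup`-mean fluctuation `⟨∫‖π_E u_j − W_j ∘ π‖²⟩` is bounded below by some
`δ > 0` for all large `j` (the no-go applied to every subsequence: a subsequence of an X-witness is an
X-witness; `exists_strictMono_tendsto_zero_of_not_eventually_le`). [folklore] -/
theorem stub_scWitnessFar :
    ∀ f : UnitAddTorus (Fin 3) → EuclideanSpace ℝ (Fin 3),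
      (∀ (s : UnitAddCircle) (x : UnitAddTorus (Fin 3)), f (x + Pi.single (2 : Fin 3) s) = f x) →
      Torus.IsSmooth f → Torus.IsDivFree f → Torus.HasZeroMean f →
      ∀ (B : ℝ) (G : ℝ≥0) (W : ℕ → ℝ → UnitAddTorus (Fin 2) → EuclideanSpace ℝ (Fin 2)),
        (∀ j, Continuous (Function.uncurry (W j))) → (∀ j t x, ‖W j t x‖ ≤ B) →
        (∀ j t, Torus.IsWeaklyDivFree (W j t)) → (∀ j t, Torus.eGradNormSq (W j t) ≤ G) →
        (∀ j s t, eLpNorm (W j t - W j s) 2 volume ≤ ENNReal.ofReal (B * |t - s|)) →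
      ∀ (ν : ℕ → ℝ) (u₀ : ℕ → UnitAddTorus (Fin 3) → EuclideanSpace ℝ (Fin 3))
        (u : ℕ → ℝ → UnitAddTorus (Fin 3) → EuclideanSpace ℝ (Fin 3)),
        (∀ j, 0 < ν j) → Tendsto ν atTop (𝓝 0) →
        (∀ j, Torus.IsGlobalLerayHopf (ν j) (fun _ => f) (u₀ j) (u j)) →
        (∀ j (t : ℝ) (s : UnitAddCircle) (x : UnitAddTorus (Fin 3)),
          u j t (x + Pi.single (2 : Fin 3) s) = u j t x) →
        (∃ E : ℝ, ∀ j, meanEnergy (u j) ≤ E) →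
        (∃ ε : ℝ, 0 < ε ∧ ∀ j, ε ≤ meanDissipation (ν j) (u j)) →
        ∃ δ : ℝ, 0 < δ ∧ ∀ᶠ j in atTop, δ ≤ longTimeAvgSup (fun t =>
          ∫ x, ‖Torus.planarProjE (u j t x) - W j t (Torus.planarProj x)‖ ^ 2) := by
  intro f hfinv hfs hfd hfz B G W hWc hWbd hWdiv hWG hWt ν u₀ u hν hν0 hLH huinv hE hεfloor
  by_contra hcon
  -- the fluctuation is nonnegative, so some subsequence of it tends to `0`
  obtain ⟨φ, hφ, hlim⟩ := exists_strictMono_tendsto_zero_of_not_eventually_le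
    (F := fun j => longTimeAvgSup (fun t =>
      ∫ x, ‖Torus.planarProjE (u j t x) - W j t (Torus.planarProj x)‖ ^ 2))
    (fun j => longTimeAvgSup_nonneg fun t => integral_nonneg fun _ => sq_nonneg _) hcon
  -- the subsequence data is again an X-witness with the same comparison class: contradiction
  exact twohalfdThesis_witness_not_sobolevCondensing f hfinv hfs hfd hfz B G (fun n => W (φ n))
    (fun n => hWc (φ n)) (fun n t x => hWbd (φ n) t x) (fun n t => hWdiv (φ n) t)
    (fun n t => hWG (φ n) t) (fun n s t => hWt (φ n) s t) (fun n => ν (φ n)) (fun n => u₀ (φ n))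
    (fun n => u (φ n)) (fun n => hν (φ n)) (hν0.comp hφ.tendsto_atTop) (fun n => hLH (φ n))
    (fun n => huinv (φ n)) (hE.imp fun E hE' n => hE' (φ n))
    (hεfloor.imp fun ε hε' => ⟨hε'.1, fun n => hε'.2 (φ n)⟩) hlim

end Summit.AnomalousDissipation.AnomalousDissipation.Theorems.TwohalfdThesis.SobolevCondensate

end
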